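import Literature.NumberTheory.GaloisCohomology.LocalInvariantMapEvaluation
import Literature.NumberTheory.GaloisCohomology.PoitouTate
import Literature.NumberTheory.GaloisRepresentations.LocalGlobalCohomologyFiniteProofs
import HarnessLib

/-!
# Kummer classes of local `n`-th powers vanish locally

The local-triviality step of Tate's proof of the reciprocity law `∑_v inv_v = 0` on `H²(Γ_K, μₙ)`
(Cassels–Fröhlich VII §10, Step 3 = §10.5): the auxiliary element `a ∈ K^×`, chosen `≡ 1` modulo the auxiliary prime
`𝔮`, is an `n`-th power in `K_w` for every `w ∣ 𝔮` (Hensel), so the cyclic class `κₙ(a) ∪ [ψ·id]`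
has vanishing local component at `w` — whatever the character `ψ` does at `w`.  This file supplies
that step in the tree's Poitou–Tate dialect (`galoisCohomology.localization`, `baseUnitsInvariant`,
`isSES_kummer … .δ₀`), for the (F1) campaign of `pub/bsd-cn100` (node T-pre: pre-reduction of a class
of `H²(Γ_K, μ_{p^m})` to one with trivial local components above `p`).

## Main statements

* `resMu_δ₀_baseUnitsInvariant` — **`Res_{E/F} κₙ(x) = κₙ(x_E)`**: the restriction
  `H¹(Γ_F, μₙ(F̄)) → H¹(Γ_E, μₙ(Ē))` (`Prop121vii.resMu F E n 1`) carries the Kummer class of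
  `x ∈ F^×` to the Kummer class of `x` in `E` (degree-one companion of the tree's
  `Prop121vii.resMu_cupProduct_δ₀_scalarCocycle`).
* `δ₀_baseUnitsInvariant_pow_eq_zero` — `κₙ(tⁿ) = 0`;
  `resMu_δ₀_baseUnitsInvariant_eq_zero_of_eq_pow` — `Res_{E/F} κₙ(x) = 0` if `x = tⁿ` in `E`.
* `localization_δ₀_baseUnitsInvariant_eq_zero_of_eq_pow`,
  `localization_cupProduct_δ₀_eq_zero_of_eq_pow` — for a number field `K` and a finite place `w`
  with `x = tⁿ` in `K_w`: `loc_w κₙ(x) = 0` and `loc_w (κₙ(x) ∪ y) = 0` for every `y`.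
* `exists_eq_pow_of_valuation_sub_one_lt` — Hensel: in a non-archimedean local field `E` with
  `|n| = 1`, every `x` with `|x − 1| < 1` is an `n`-th power;
  `exists_algebraMap_adicCompletion_eq_pow` — the number-field form (`w ∤ n`, `w(x − 1) < 1` ⇒
  `x ∈ (K_wˣ)ⁿ`).
* `localization_cupProduct_δ₀_eq_zero_of_valuation_sub_one_lt` — the combination:
  `w ∤ n`, `x ≡ 1 (mod 𝔭_w)` ⇒ `loc_w (κₙ(x) ∪ y) = 0`.

## References

* J. Tate, *Global class field theory*, in Cassels–Fröhlich, *Algebraic Number Theory* (1967),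
  Ch. VII §10 (proof of the reciprocity law), §10.5 (Step 3: cyclic cyclotomic splitting fields;
  PDF pp. 230–231 of the held copy `book:editornd-algebraic-number-theory`).
* J.-P. Serre, *Galois Cohomology* (1997), II §1.2 (Kummer theory). [SerreGaloisCohomology1997]
* J. Neukirch, *Algebraic Number Theory* (1999), Ch. II (4.6), (5.7)–(5.8) (Hensel's lemma,
  principal units and `n`-th powers). [NeukirchANT1999]
* J. Neukirch, A. Schmidt, K. Wingberg, *Cohomology of Number Fields* (2008), I §5
  (compatible pairs, functoriality). [NeukirchSchmidtWingberg2008]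
-/

noncomputable section

open CategoryTheory Function NumberField IsDedekindDomain Field ValuativeRel
open scoped NumberField

universe u

namespace Literature.NumberTheory.GaloisCohomology

open _root_.ContinuousCohomology
open Literature.NumberTheory.GaloisRepresentations
open Literature.NumberTheory.GaloisRepresentations.DiscreteGaloisModule
open Literature.AnabelianGeometry.AbsoluteAnabelian
open Literature.AnabelianGeometry.AbsoluteAnabelian.Prop121vii

/-! ### §1. The Kummer class under restriction to an extension (degree one) -/

section Fields

variable (F E : Type u) [Field F] [Field E] [Algebra F E] {n : ℕ} [NeZero n]

/-- `unitsVal (u - v) = unitsVal u / unitsVal v`. [folklore] -/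
private theorem unitsVal_sub' (K : Type u) [Field K] (u v : UnitsCarrier K) :
    unitsVal K (u - v) = unitsVal K u / unitsVal K v := rfl

/-- `ι (algebraMap F F̄ x) = algebraMap E Ē (algebraMap F E x)`. [folklore] -/
private theorem absClosureEmbedding_algebraMap' (x : F) :
    absClosureEmbedding F E (algebraMap F (AlgebraicClosure F) x) =
      algebraMap E (AlgebraicClosure E) (algebraMap F E x) := by
  rw [(absClosureEmbedding F E).commutes x, IsScalarTower.algebraMap_apply F E (AlgebraicClosure E)]

/-- **The Kummer class restricts to the Kummer class**: for an extension `E/F` and `x ∈ F^×`,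
the restriction `Res : H¹(Γ_F, μₙ(F̄)) → H¹(Γ_E, μₙ(Ē))` along the compatible pair
`(Γ_E → Γ_F, ι : F̄ → Ē)` (`Prop121vii.resMu F E n 1`) carries the Kummer class `κₙ(x) = δ₀(x)` of
`F` to the Kummer class of `x` viewed in `E` — naturality of the connecting homomorphism of the
Kummer sequences `0 → μₙ → K̄ˣ → K̄ˣ → 0`, which `ι` maps to each other (an `n`-th root `w` of `x`
in `F̄` goes to the `n`-th root `ι w` in `Ē`).  The degree-one companion of the cup-product
computation `Prop121vii.resMu_cupProduct_δ₀_scalarCocycle`.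
Ref: Neukirch–Schmidt–Wingberg, *Cohomology of Number Fields* (2008), I §5 (compatible pairs) and
the Kummer sequence; Serre, *Galois Cohomology* (1997), II §1.2.
[cite: SerreGaloisCohomology1997, II §1.2] -/
theorem resMu_δ₀_baseUnitsInvariant (x : F) (hx : x ≠ 0) (hx' : algebraMap F E x ≠ 0) :
    resMu F E n 1 ((isSES_kummer F n (NeZero.pos n)).δ₀ (baseUnitsInvariant F x hx)) =
      (isSES_kummer E n (NeZero.pos n)).δ₀ (baseUnitsInvariant E (algebraMap F E x) hx') := by
  have hn : 0 < n := NeZero.pos n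
  have hF := isSES_kummer F n hn
  have hE := isSES_kummer E n hn
  set uF := baseUnitsInvariant F x hx with huF
  set uE := baseUnitsInvariant E (algebraMap F E x) hx' with huE
  -- an `n`-th root `w` of `x` in `F̄ˣ`, and its image `w'` in `Ēˣ`
  obtain ⟨w, hw⟩ := hF.surjective (uF : UnitsCarrier F)
  have hwn : unitsVal F w ^ n = unitsVal F (uF : UnitsCarrier F) := by
    have e := congrArg (unitsVal F) hw
    rwa [kummerπ_hom_apply, unitsVal_zsmul, zpow_natCast] at e
  let ι : (AlgebraicClosure F)ˣ →* (AlgebraicClosure E)ˣ :=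
    Units.map (absClosureEmbedding F E).toRingHom.toMonoidHom
  have hι : ∀ y : (AlgebraicClosure F)ˣ, ((ι y : (AlgebraicClosure E)ˣ) : AlgebraicClosure E) =
      absClosureEmbedding F E (y : AlgebraicClosure F) := fun y => rfl
  let w' : UnitsCarrier E := UnitsCarrier.ofUnits (ι (unitsVal F w))
  have hw' : (kummerπ E n).hom w' = (uE : UnitsCarrier E) := by
    apply unitsVal_injective E
    rw [kummerπ_hom_apply, unitsVal_zsmul, zpow_natCast]
    change ι (unitsVal F w) ^ n = unitsVal E (uE : UnitsCarrier E)
    rw [← map_pow, hwn]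
    refine Units.ext ?_
    rw [hι, huF, coe_unitsVal_baseUnitsInvariant, huE, coe_unitsVal_baseUnitsInvariant,
      absClosureEmbedding_algebraMap']
  have hwinv : (kummerπ F n).hom w ∈ (units F).toTopRep.ρ.invariants := by rw [hw]; exact uF.2
  have hw'inv : (kummerπ E n).hom w' ∈ (units E).toTopRep.ρ.invariants := by rw [hw']; exact uE.2
  -- the Kummer cocycles correspond under `(res, ι)`
  have hδ : ∀ σ : absoluteGaloisGroup E,
      muRes F E n ((hF.δ₀Cocycle w hwinv).1 (absGaloisRestrict F E σ)) = (hE.δ₀Cocycle w' hw'inv).1 σ := by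
    intro σ
    apply hE.injective
    apply unitsVal_injective E
    rw [hE.f_δ₀Cocycle_apply, unitsVal_kummerι, muVal_muRes, ← unitsVal_kummerι, hF.f_δ₀Cocycle_apply,
      unitsVal_sub', unitsVal_sub', map_div, unitsVal_apply, unitsVal_apply]
    congr 1
    refine Units.ext ?_
    change absClosureEmbedding F E (((absGaloisRestrict F E σ • unitsVal F w : (AlgebraicClosure F)ˣ) :
      AlgebraicClosure F)) = ((σ • ι (unitsVal F w) : (AlgebraicClosure E)ˣ) : AlgebraicClosure E)
    rw [Units.coe_smul, Units.coe_smul, absGaloisRestrict_apply_smul]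
    rfl
  rw [hF.δ₀_apply_eq uF w hw, hE.δ₀_apply_eq uE w' hw', resMu_apply, map_oneCocycleClass]
  refine congrArg (oneCocycleClass _) (Subtype.ext (ContinuousMap.ext fun σ => ?_))
  rw [contOneCocycles.pullback_apply, resCoeff_hom_apply]
  exact hδ σ

omit [Algebra F E] in
/-- `baseUnitsInvariant` only depends on the element (proof-irrelevance helper). [folklore] -/
private theorem baseUnitsInvariant_congr' {x y : E} (hx : x ≠ 0) (hy : y ≠ 0) (h : x = y) :
    baseUnitsInvariant E x hx = baseUnitsInvariant E y hy := by
  subst h; rfl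

omit [Algebra F E] in
/-- **The Kummer class of an `n`-th power vanishes**: `κₙ(tⁿ) = δ₀(n • (t)) = 0` (exactness of the
Kummer sequence at `H⁰`: `δ₀ ∘ (n-th power) = 0`, `IsSES.δ₀_eq_zero_iff`).
[cite: SerreGaloisCohomology1997, II §1.2] -/
theorem δ₀_baseUnitsInvariant_pow_eq_zero (t : E) (ht : t ≠ 0) :
    (isSES_kummer E n (NeZero.pos n)).δ₀ (baseUnitsInvariant E (t ^ n) (pow_ne_zero n ht)) = 0 := by
  rw [IsSES.δ₀_eq_zero_iff]
  refine ⟨(baseUnitsInvariant E t ht : UnitsCarrier E), (baseUnitsInvariant E t ht).2, ?_⟩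
  rw [kummerπ_hom_apply, baseUnitsInvariant_pow, Submodule.coe_smul]

/-- **The Kummer class of `x ∈ F^×` dies in any extension `E` in which `x` becomes an `n`-th power**:
`Res_{E/F} κₙ(x) = κₙ(x_E) = κₙ(tⁿ) = 0`. [cite: SerreGaloisCohomology1997, II §1.2] -/
theorem resMu_δ₀_baseUnitsInvariant_eq_zero_of_eq_pow (x : F) (hx : x ≠ 0) {t : E}
    (ht : algebraMap F E x = t ^ n) :
    resMu F E n 1 ((isSES_kummer F n (NeZero.pos n)).δ₀ (baseUnitsInvariant F x hx)) = 0 := by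
  have hx' : algebraMap F E x ≠ 0 := (map_ne_zero_iff _ (algebraMap F E).injective).2 hx
  have ht0 : t ≠ 0 := by
    rintro rfl
    rw [zero_pow (NeZero.ne n)] at ht
    exact hx' ht
  rw [resMu_δ₀_baseUnitsInvariant F E x hx hx', baseUnitsInvariant_congr' E hx' (pow_ne_zero n ht0) ht]
  exact δ₀_baseUnitsInvariant_pow_eq_zero E t ht0

end Fields

/-! ### §2. Number fields: the localisation of the Kummer class of a local `n`-th power vanishes -/

section NumberField

variable {K : Type u} [Field K] [NumberField K] {n : ℕ} [NeZero n]

/-- **`loc_w κₙ(x) = 0` when `x` is an `n`-th power in `K_w`.**  For `x ∈ K^×` and a finite place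
`w` such that `x = tⁿ` in the completion `K_w`, the localisation at `w` of the global Kummer class
`κₙ(x) ∈ H¹(Γ_K, μₙ)` vanishes in `H¹(Γ_{K_w}, μₙ(K̄)|)` (Poitou–Tate dialect): transported along
`μₙ(K̄)| ≅ μₙ(K̄_w)` (`muLocalIso`, transfer-2's `cohomologyMap_muLocalIso_localization`) it is the
Kummer class of `x` in `K_w` (`resMu_δ₀_baseUnitsInvariant`), which vanishes.
Ref: Serre, *Galois Cohomology* (1997), II §1.2; Milne, *Arithmetic Duality Theorems* (2006), I §2
(local conditions given by `n`-th powers). [cite: SerreGaloisCohomology1997, II §1.2] -/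
theorem localization_δ₀_baseUnitsInvariant_eq_zero_of_eq_pow (w : HeightOneSpectrum (𝓞 K)) (x : K)
    (hx : x ≠ 0) {t : w.adicCompletion K} (ht : algebraMap K (w.adicCompletion K) x = t ^ n) :
    galoisCohomology.localization (mu K n) (Sum.inr w) 1
      ((isSES_kummer K n (NeZero.pos n)).δ₀ (baseUnitsInvariant K x hx)) = 0 := by
  have hinj : Injective (fun c => (cohomologyMap (muLocalIso w n).hom 1).hom c) :=
    (continuousCohomologyEquivOfIso (muLocalIso w n) 1).injective
  apply hinj
  change (cohomologyMap (muLocalIso w n).hom 1).hom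
      (galoisCohomology.localization (mu K n) (Sum.inr w) 1 _) =
    (cohomologyMap (muLocalIso w n).hom 1).hom 0
  rw [map_zero, cohomologyMap_muLocalIso_localization]
  exact resMu_δ₀_baseUnitsInvariant_eq_zero_of_eq_pow K (w.adicCompletion K) x hx ht

/-- **The local component at `w` of every cup product `κₙ(x) ∪ y` vanishes when `x` is an `n`-th
power in `K_w`** (`loc_w (κₙ(x) ∪ y) = loc_w κₙ(x) ∪ loc_w y = 0`, localisation commutes with cup
products, `LocalInvariants.localization_cupProduct`).  This is the local-triviality clause used for
the auxiliary cyclic classes `κₙ(a) ∪ [ψ·id]` of the reciprocity law at the places where `ψ` ramifies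
(`a` chosen to be a local `n`-th power there).
Ref: Tate, in Cassels–Fröhlich (1967), VII §10.5; Serre, *Galois Cohomology* (1997), II §1.2.
[cite: SerreGaloisCohomology1997, II §1.2] -/
theorem localization_cupProduct_δ₀_eq_zero_of_eq_pow (w : HeightOneSpectrum (𝓞 K)) (x : K)
    (hx : x ≠ 0) {t : w.adicCompletion K} (ht : algebraMap K (w.adicCompletion K) x = t ^ n)
    (y : galoisCohomology ((mu K n).tateDual n) 1) :
    haveI : CompactSpace (absoluteGaloisGroup K) := absoluteGaloisGroup_compactSpace K
    galoisCohomology.localization (mu K n) (Sum.inr w) 2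
      (((mu K n).tateDualPairing n).cupProduct
        ((isSES_kummer K n (NeZero.pos n)).δ₀ (baseUnitsInvariant K x hx)) y) = 0 := by
  haveI : CompactSpace (absoluteGaloisGroup K) := absoluteGaloisGroup_compactSpace K
  haveI : CompactSpace (absoluteGaloisGroup (Place.Completion (K := K) (Sum.inr w))) :=
    absoluteGaloisGroup_compactSpace _
  rw [LocalInvariants.localization_cupProduct, localization_δ₀_baseUnitsInvariant_eq_zero_of_eq_pow w x hx ht,
    map_zero, AddMonoidHom.zero_apply]

end NumberField

/-! ### §3. Principal units are `n`-th powers away from `n` (Hensel) -/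

section Hensel

variable (E : Type*) [Field E] [ValuativeRel E] [TopologicalSpace E] [IsNonarchimedeanLocalField E]

/-- **`x ≡ 1 (mod 𝔪)` with `|n| = 1` is an `n`-th power** in a non-archimedean local field: write
`x = 1 + n²·w` with `w = (x − 1)/n² ∈ 𝔪` and apply Hensel's lemma in the form
`1 + n²𝔪 ⊆ (𝒪ˣ)ⁿ` (tree `exists_units_pow_eq_one_add`, `henselianLocalRing_integer`; the argument
of the tree's `mem_of_valuation_sub_one_lt`).
Ref: Neukirch, *Algebraic Number Theory* (1999), Ch. II (5.7)–(5.8); Cassels, *Local Fields*, Ch. 4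
Lemma 3.1; Serre, *Local Fields*, XIV §4. [cite: NeukirchANT1999, Ch. II §5 (5.7)] -/
theorem exists_eq_pow_of_valuation_sub_one_lt (n : ℕ) (hn : valuation E (n : E) = 1)
    {x : E} (hx : valuation E (x - 1) < 1) : ∃ t : E, x = t ^ n := by
  have hn0 : (n : E) ≠ 0 := by
    intro h
    rw [h, map_zero] at hn
    exact zero_ne_one hn
  have hn2 : (n : E) ^ 2 ≠ 0 := pow_ne_zero _ hn0
  -- `w = (x - 1) / n²` lies in the maximal ideal
  set w : E := (x - 1) / (n : E) ^ 2 with hw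
  have hvw : valuation E w < 1 := by
    rw [hw, map_div₀, map_pow, hn, one_pow, div_one]
    exact hx
  have hwint : w ∈ 𝒪[E] := (Valuation.mem_integer_iff _ _).mpr hvw.le
  set wO : 𝒪[E] := ⟨w, hwint⟩ with hwO
  have hwmax : wO ∈ 𝓂[E] := by
    rw [IsLocalRing.mem_maximalIdeal, mem_nonunits_iff,
      (Valuation.integer.integers (valuation E)).isUnit_iff_valuation_eq_one]
    exact hvw.ne
  -- Hensel
  letI : UniformSpace E := IsTopologicalAddGroup.rightUniformSpace E
  haveI : IsUniformAddGroup E := isUniformAddGroup_of_addCommGroup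
  haveI : HenselianLocalRing 𝒪[E] := henselianLocalRing_integer E
  obtain ⟨a, ha, -⟩ := exists_units_pow_eq_one_add n hwmax
  refine ⟨((a : 𝒪[E]) : E), ?_⟩
  have h1 : (((a : 𝒪[E]) : E)) ^ n = (((a : 𝒪[E]) ^ n : 𝒪[E]) : E) := by
    rw [SubmonoidClass.coe_pow]
  have h2 : ((wO : 𝒪[E]) : E) = w := rfl
  rw [h1, ha]
  push_cast
  rw [h2, hw]
  field_simp
  ring

end Hensel

/-! ### §4. Number fields: `x ≡ 1 (mod w)`, `w ∤ n` ⇒ `x ∈ (K_w^×)ⁿ`, hence `loc_w (κₙ(x) ∪ y) = 0` -/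

section NumberFieldHensel

variable {K : Type u} [Field K] [NumberField K]

/-- **A `w`-adic principal unit is an `n`-th power in `K_w` when `w ∤ n`.**  For a finite place `w`
of the number field `K` with `n ∉ w` and `x ∈ K` with `w(x − 1) < 1` (i.e. `x ≡ 1 (mod 𝔭_w)`),
`x` is an `n`-th power in the completion `K_w` (Hensel's lemma, `exists_eq_pow_of_valuation_sub_one_lt`
for the local field `K_w` — the tree's `IsNonarchimedeanLocalField (w.adicCompletion K)` —
transported along the equivalence of `Valued.v` with the valuation of its valuative relation).
Ref: Neukirch, *Algebraic Number Theory* (1999), Ch. II (5.7)–(5.8).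
[cite: NeukirchANT1999, Ch. II §5 (5.7)] -/
theorem exists_algebraMap_adicCompletion_eq_pow (w : HeightOneSpectrum (𝓞 K)) {n : ℕ}
    (hn : ((n : 𝓞 K)) ∉ w.asIdeal) {x : K} (hx : w.valuation K (x - 1) < 1) :
    ∃ t : w.adicCompletion K, algebraMap K (w.adicCompletion K) x = t ^ n := by
  set ι : K →+* w.adicCompletion K := algebraMap K (w.adicCompletion K) with hι_def
  have hιv : ∀ k : K, Valued.v (ι k) = w.valuation K k := fun k =>
    HeightOneSpectrum.adicCompletion.valued_coe (K := K) (v := w) k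
  have heqv : (Valued.v : Valuation (w.adicCompletion K) _).IsEquiv
      (valuation (w.adicCompletion K)) :=
    ValuativeRel.isEquiv _ _
  have hn' : valuation (w.adicCompletion K) (n : w.adicCompletion K) = 1 := by
    rw [← heqv.eq_one_iff_eq_one, ← map_natCast ι, hιv, ← map_natCast (algebraMap (𝓞 K) K),
      HeightOneSpectrum.valuation_of_algebraMap]
    exact HeightOneSpectrum.intValuation_eq_one_iff.2 hn
  have hx' : valuation (w.adicCompletion K) (ι x - 1) < 1 := by
    rw [← heqv.lt_one_iff_lt_one, ← map_one ι, ← map_sub, hιv]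
    exact hx
  exact exists_eq_pow_of_valuation_sub_one_lt (w.adicCompletion K) n hn' hx'

/-- **Local triviality of the auxiliary cyclic classes at the ramified places.**  For a finite
place `w ∤ n` of `K`, `x ∈ K^×` with `x ≡ 1 (mod 𝔭_w)`, and any `y ∈ H¹(Γ_K, μₙ^∨(1))` (e.g. the
class `[ψ·id]` of a cyclic character), the local component at `w` of `κₙ(x) ∪ y ∈ H²(Γ_K, μₙ)`
vanishes: `x ∈ (K_w^×)ⁿ` (`exists_algebraMap_adicCompletion_eq_pow`), so `loc_w κₙ(x) = 0`
(`localization_δ₀_baseUnitsInvariant_eq_zero_of_eq_pow`).  In Tate's proof of the reciprocity law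
for `H²(μₙ)` this is how the auxiliary element `a ≡ 1 (mod 𝔮)` is made locally trivial at the primes
`𝔮` where the auxiliary cyclotomic character ramifies.
Ref: Tate, *Global class field theory*, in Cassels–Fröhlich (1967), VII §10.5; Serre, *Galois
Cohomology* (1997), II §1.2. [cite: SerreGaloisCohomology1997, II §1.2] -/
theorem localization_cupProduct_δ₀_eq_zero_of_valuation_sub_one_lt {n : ℕ} [NeZero n]
    (w : HeightOneSpectrum (𝓞 K)) (hn : ((n : 𝓞 K)) ∉ w.asIdeal) (x : K) (hx : x ≠ 0)
    (hx1 : w.valuation K (x - 1) < 1) (y : galoisCohomology ((mu K n).tateDual n) 1) :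
    haveI : CompactSpace (absoluteGaloisGroup K) := absoluteGaloisGroup_compactSpace K
    galoisCohomology.localization (mu K n) (Sum.inr w) 2
      (((mu K n).tateDualPairing n).cupProduct
        ((isSES_kummer K n (NeZero.pos n)).δ₀ (baseUnitsInvariant K x hx)) y) = 0 := by
  obtain ⟨t, ht⟩ := exists_algebraMap_adicCompletion_eq_pow w hn hx1
  exact localization_cupProduct_δ₀_eq_zero_of_eq_pow w x hx ht y

end NumberFieldHensel

end Literature.NumberTheory.GaloisCohomology

end
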